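/-
Origin: expansion seat `planner-pub-hodgecm-pv09-g3-0`, handover 2026-08-18T05:59:23Z (`HOME/pub-hodgecm-pv09-g3/lean/Pv09g3/Measurability.lean`, md5 d20ee1e5, 131 lines);
landed by the gen-6 packager in gate run 24 as `HodgeCM/PerL34/Measurability.lean` (import ^import Pv[0-9]+g[0-9]+\.→import HodgeCM.PerL34. ×1).
-/
/-
Copyright: HodgeCM publication cell (pub-hodgecm), DAG node N31 — seam S3 / seam (I) (prover pv09, gen 3).
Released under the package licence.

# The measurability hypothesis `hfm` from STRONG CONTINUITY of `ω` at `φ` — the final form of the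
# canonical `LocalFactorPieces` / `θ ≠ 0`

Source under adjudication (NOT cited as a fact; this file PROVES a typed piece of it):
PerL v5 = `inputs/2001/summits__hodge-w-picard-modular-quadrilinear-period-galois-
closure__free__y1__paper__paper.tex`, Lemma 4.2(b), proof, tex l. 611 (the adelic integral
`∫_{U(W_i)(𝔸)} ⟨ω(y)φ,φ⟩ χ′(y) dy` — its integrand must be measurable for the adelic measure).

## What this file does

Items 3/5/7/8 keep `hfm : AEStronglyMeasurable (y ↦ ⟪φ, ω y φ⟫ · χ′(y)) D.μ`.  pv09-g2's
`RestrictedMeasure.borelSpace` (LANDED run 22: the trace σ-algebra `instMeasurableSpace` on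
`Πʳ_i [G_i, B_i]` IS the Borel σ-algebra of the restricted-product topology, for countable `ι`,
second-countable `G_i`, measurable `B_i`) turns it into a CONTINUITY statement:
* `hfm_of_continuous` : `Continuous (y ↦ ω y φ)` (strong continuity of the unitary representation at the
  vector `φ`) and `Continuous χ′` ⇒ `hfm`;
* **`canonicalPiecesFinal`**, `canonicalPiecesFinal_I`, **`rallis_final`**, **`theta_ne_zero_final`** :
  item 8's `canonicalPieces'` / `rallis_canonical'` / `theta_ne_zero_canonical'` with `hfm` replaced by
  `hω : Continuous fun y => ω y φ` (and `hcl` already shrunk to `S`).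
FINAL HYPOTHESIS LIST of `theta_ne_zero_final` (the S3 residual for the canonical restricted-product
data): `B_i` open subgroups; `D` with `IsCoordinate D` (pv09-g2 `ofHaar` provides one); `‖φ‖ = 1`;
`Continuous (y ↦ ω y φ)`; `Continuous χ′` and a level `K_{T′} ≤ ker χ′` (EXISTS, pv10); `0 < c`,
`0 < vol 𝓕 < ∞`, `θ ∈ Θ`, `hN31e` (pv09 N31e shape), `hnorm` (pv05 shape); `hK` (φ is `K_T`-fixed) and `hM`
(product formula on finite sub-products) — the D4/D5 posited restricted tensor product; per place:
`UnramifiedPlaceData` outside `S ⊇ T ∪ T′` (split: Schrödinger-model shell identity; non-split: `B_i = G_i`,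
`ν_i(G_i) = 1`), and at `i ∈ S`: integrability of `localCoeff_i` and `0 < I_i` (N31f models, pv07);
`summable_t` (pv13 PROVES it for number-field places).  Nothing is cited; no hypothesis names PerL,
QW8 or a 2001-programme claim.  Imports: item 8.  Axioms = the standard trio.
Unit `pub-hodgecm-pv09-g3` (DAG-node prover #09, generation 3), 2026-08-18.
-/
import Summits.HodgeConjecture.HodgeCM.PerL34.LocalIntegrability

/-! PORT of `HodgeCM/PerL34/Measurability.lean` (HodgeCMPerL run 82) — verbatim mechanical port; provenance in the PORT header line. -/

set_option autoImplicit false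

noncomputable section

open MeasureTheory Set Filter Function Topology Complex ComplexConjugate

open scoped RestrictedProduct InnerProductSpace

namespace HodgeCM.PerL34.PureTensor

open HodgeCM.PerL34.AdelicFactorisation HodgeCM.PerL34.RestrictedMeasure
  HodgeCM.PerL34.NoSmallSubgroups HodgeCM.PerL34.EulerFactorisation

section hfm

variable {ι : Type} {G : ι → Type} [∀ i, Group (G i)]
  [∀ i, TopologicalSpace (G i)] [∀ i, MeasurableSpace (G i)] [∀ i, BorelSpace (G i)]
  [Countable ι] [∀ i, SecondCountableTopology (G i)]
  {Sub : ι → Type*} [∀ i, SetLike (Sub i) (G i)] [∀ i, SubgroupClass (Sub i) (G i)]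
  (B : ∀ i, Sub i)
  {Sp : Type} [NormedAddCommGroup Sp] [InnerProductSpace ℂ Sp]

/-- **`hfm` from strong continuity**: on the restricted product (Borel = trace σ-algebra, pv09-g2), the
integrand `y ↦ ⟪φ, ω y φ⟫ · χ′(y)` is a.e.-strongly measurable for ANY measure as soon as `y ↦ ω y φ` and
`χ′` are continuous. -/
theorem hfm_of_continuous (hBm : ∀ i, MeasurableSet (B i : Set (G i)))
    (ω : (Πʳ j, [G j, B j]) →* (Sp ≃ₗᵢ[ℂ] Sp)) (φ : Sp) (hω : Continuous fun y => ω y φ)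
    (χ : (Πʳ j, [G j, B j]) →* Circle) (hχ : Continuous χ) (μ : Measure (Πʳ j, [G j, B j])) :
    AEStronglyMeasurable (fun y => inner ℂ φ (ω y φ) * ((χ y : Circle) : ℂ)) μ := by
  haveI : BorelSpace (Πʳ j, [G j, B j]) :=
    RestrictedMeasure.borelSpace (fun i => (B i : Set (G i))) hBm
  exact ((continuous_const.inner hω).mul (continuous_subtype_val.comp hχ)).aestronglyMeasurable

end hfm

section final

variable {ι : Type} {G : ι → Type} [∀ i, CommGroup (G i)] [∀ i, MeasurableSpace (G i)]
  [∀ i, MeasurableInv (G i)] [∀ i, TopologicalSpace (G i)] [∀ i, BorelSpace (G i)]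
  [∀ i, SecondCountableTopology (G i)]
  {Sub : ι → Type*} [∀ i, SetLike (Sub i) (G i)] [∀ i, SubgroupClass (Sub i) (G i)]
  (B : ∀ i, Sub i) [DecidableEq ι] [Countable ι]
  {Sp : Type} [NormedAddCommGroup Sp] [InnerProductSpace ℂ Sp]
  {E : Type*} [NormedAddCommGroup E] [InnerProductSpace ℂ E]
  (hBopen : ∀ i, IsOpen (B i : Set (G i)))
  (D : RestrictedProductMeasureDatum ι G (Πʳ j, [G j, B j])) [∀ i, (D.ν i).IsInvInvariant]
  (hD : IsCoordinate D) (ω : (Πʳ j, [G j, B j]) →* (Sp ≃ₗᵢ[ℂ] Sp)) (φ : Sp) (hφ : ‖φ‖ = 1)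
  (hω : Continuous fun y => ω y φ)
  (χ : (Πʳ j, [G j, B j]) →* Circle) (hχ : Continuous χ)
  (𝓕 : Set (Πʳ j, [G j, B j])) (K : (Πʳ j, [G j, B j]) → (Πʳ j, [G j, B j]) → ℂ) (c : ℝ)
  (c_pos : 0 < c) (vol_ne_zero : D.μ 𝓕 ≠ 0) (vol_ne_top : D.μ 𝓕 ≠ ⊤) (θ : E) (Θ : Set E)
  (hθ : θ ∈ Θ)
  (hN31e : RallisIP.N31e_statement D.μ 𝓕 ω φ (fun y => ((χ y : Circle) : ℂ)) K (c : ℂ))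
  (hnorm : ⟪θ, θ⟫_ℂ = ∫ u in 𝓕, ∫ u' in 𝓕, ((χ u : Circle) : ℂ) * conj ((χ u' : Circle) : ℂ) *
    K u u' ∂D.μ ∂D.μ)
  {T T' : Finset ι} (hK : ∀ k ∈ RestrictedProduct.boxSubgroup B T, ω k φ = φ)
  (hχT' : RestrictedProduct.boxSubgroup B T' ≤ χ.ker)
  (hM : ∀ S : Finset ι, T ⊆ S → ∀ y : (i : ↥S) → G i,
    inner ℂ φ (ω (extendOne B S y) φ) = ∏ i : ↥S, localCoeff B ω φ i (y i))
  {S : Finset ι} {q : ι → ℕ} {chiPi nuPi : ι → ℂ} {IsSplit : ι → Prop}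
  (X : UnramifiedPlaceData B D ω φ χ S q chiPi nuPi IsSplit) (hTS : T ⊆ S) (hT'S : T' ⊆ S)
  (hclS : ∀ i ∈ S, Integrable (localCoeff B ω φ i) (D.ν i))
  (ram_pos : ∀ i ∈ S, 0 < (localIntegrand B D ω φ χ i).I)
  (hsum : Summable fun i : {j : ι // j ∉ S} => EulerProduct.tOf (q i.1))

include hBopen hD hφ hω hχ c_pos vol_ne_zero vol_ne_top hθ hN31e hnorm hK hχT' hM X hTS hT'S hclS
  ram_pos hsum

/-- **The canonical `LocalFactorPieces`, final form** (`hfm` from continuity, `hcl` shrunk to `S`). -/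
def canonicalPiecesFinal : LocalFactorPieces ι E :=
  canonicalPieces' B hBopen D hD ω φ hφ χ hχ 𝓕 K c c_pos vol_ne_zero vol_ne_top θ Θ hθ hN31e hnorm
    hK hχT' hM
    (hfm_of_continuous B (fun i => (hBopen i).measurableSet) ω φ hω χ hχ D.μ)
    X hTS hT'S hclS ram_pos hsum

/-- (Ported verbatim from the HodgeCMPerL package; no docstring in the source.) -/
theorem canonicalPiecesFinal_I (i : ι) :
    (canonicalPiecesFinal B hBopen D hD ω φ hφ hω χ hχ 𝓕 K c c_pos vol_ne_zero vol_ne_top θ Θ hθ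
      hN31e hnorm hK hχT' hM X hTS hT'S hclS ram_pos hsum).I i = (localIntegrand B D ω φ χ i).I := rfl

/-- **Rallis, final form**: `re ⟪θ, θ⟫ = c · vol([U(W_i)]) · ∏' I_i`. -/
theorem rallis_final :
    RCLike.re ⟪θ, θ⟫_ℂ = c * (D.μ 𝓕).toReal * ∏' i, (localIntegrand B D ω φ χ i).I :=
  (canonicalPiecesFinal B hBopen D hD ω φ hφ hω χ hχ 𝓕 K c c_pos vol_ne_zero vol_ne_top θ Θ hθ
    hN31e hnorm hK hχT' hM X hTS hT'S hclS ram_pos hsum).rallis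

/-- **N31h for the canonical data, final form**: `θ ≠ 0`. -/
theorem theta_ne_zero_final : θ ≠ 0 :=
  (canonicalPiecesFinal B hBopen D hD ω φ hφ hω χ hχ 𝓕 K c c_pos vol_ne_zero vol_ne_top θ Θ hθ
    hN31e hnorm hK hχT' hM X hTS hT'S hclS ram_pos hsum).toLocalFactorDatum.theta_ne_zero

end final

end HodgeCM.PerL34.PureTensor

end
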